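import Summits.RiemannHypothesis.RiemannHypothesis.Theorems.WeilFormatCLogTailSums
import Summits.RiemannHypothesis.RiemannHypothesis.Theorems.WeilFormatCPolyWindowConstantsBox
import Literature.Analysis.SpecialFunctions.HurwitzZetaRationalEnclosure
import HarnessLib

/-!
# Format C, design C∞ (E2c, data side): FAR-TAIL boxes of the Hankel family-Gram entries for the tags `1` and `log m`

Route context: Fourier–Galerkin / Schur-complement certificates of Weil positivity on a window ("format C", C∞ door;
cell memo `run/shared/lean/pub/rh-explicit/rh-explicit-weil-2/gen15/E2-PLAN-v2.md` §5.5 (E2c); supporting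
stmt-RiemannHypothesis-0098; seat rh-explicit-weil-2).  A Hankel entry of the rescaled families
(`WeilFormatCCinfGramHankel`) is `Σ'_{k≥0} T_t T_{t'} (m₀/(m₀+k))^s`; the generator splits it into an EXACT range
`m ∈ [m₀, B₄)` (interval arithmetic per mode) and a FAR tail from `B₄` (`WeilFormatCFamilyGram.tsum_shift_eq_sum_Ico_add_tsum_shift`).
This file boxes the far tails of the three trig-free entries, rescaled by `m₀^s` BEFORE rounding (the raw tails
underflow any fixed-point scale):

* `CinfCoeff.pureFarScaledBox ∋ Σ'_k (m₀/(B₄+k))^s` — Hurwitz Euler–Maclaurin (`abs_tsum_inv_pow_sub_hurwitzNatMain_le`, `c := B₄`);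
* `CinfCoeff.logFarScaledBox ∋ Σ'_k log(B₄+k)·(m₀/(B₄+k))^s` — the two-sided `F_{s−1}` bounds of `WeilFormatCLogTailSums`
  (`le_tsum_log_div_add_pow`, `summable_log_div_add_pow`), `log B₄`, `log(B₄−1)` by `MI.logNat`;
* `CinfCoeff.logSqFarScaledBox ∋ Σ'_k log²(B₄+k)·(m₀/(B₄+k))^s` — the `G_{s−1}` bounds (`le_tsum_logSq_div_add_pow`,
  `summable_logSq_div_add_pow`).

Interval plumbing only; standard axioms; no RH claim.
-/

set_option autoImplicit false
-- `Summit.RiemannHypothesis.RiemannHypothesis.…` is the layout-mandated namespace (summit = problem name).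
set_option linter.dupNamespace false

namespace Summit.RiemannHypothesis.RiemannHypothesis.Theorems.WeilFormatC

open Literature.Analysis.SpecialFunctions
open Literature.Analysis.ValidatedNumerics Literature.Analysis.ValidatedNumerics.NumericsMP

namespace CinfCoeff

open WinConst (ratBox mem_ratBox mulRatBox mem_mulRatBox)

variable {S : ℕ}

/-! ## Pure tag: `Σ'_k (m₀/(B₄+k))^s` -/

/-- **Far pure tail, rescaled**: `[m₀^s(main − tail), m₀^s(main + tail)]` of the Hurwitz Euler–Maclaurin enclosure at
`c = B₄` (shift `J`, order `ν`), exact rational scaling, rounded outward to scale `S`. -/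
def pureFarScaledBox (S : ℕ) (m₀ B₄ s J ν : ℕ) : MI :=
  ⟨(ratBox S ((m₀ : ℚ) ^ s * (hurwitzNatMain (B₄ : ℚ) J ν s - hurwitzNatTail (B₄ : ℚ) J ν s))).lo,
   (ratBox S ((m₀ : ℚ) ^ s * (hurwitzNatMain (B₄ : ℚ) J ν s + hurwitzNatTail (B₄ : ℚ) J ν s))).hi⟩

/-- **`pureFarScaledBox ∋ Σ'_k (m₀/(B₄+k))^s`** (`B₄ ≥ 1`, `s ≥ 2`, `ν ≥ 1`). -/
theorem mem_pureFarScaledBox {m₀ B₄ s : ℕ} (hB₄ : 0 < B₄) (hs : 2 ≤ s) (J : ℕ) {ν : ℕ} (hν : ν ≠ 0) :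
    MI.mem S (∑' k : ℕ, ((m₀ : ℝ) / ((B₄ + k : ℕ) : ℝ)) ^ s) (pureFarScaledBox S m₀ B₄ s J ν) := by
  have e : (fun k : ℕ ↦ ((m₀ : ℝ) / ((B₄ + k : ℕ) : ℝ)) ^ s)
      = fun k : ℕ ↦ (m₀ : ℝ) ^ s * (((k : ℝ) + ((B₄ : ℚ) : ℝ)) ^ s)⁻¹ := by
    funext k; push_cast; rw [div_pow, div_eq_mul_inv, add_comm]
  rw [e, tsum_mul_left]
  have hc : (0 : ℚ) < (B₄ : ℚ) := by exact_mod_cast hB₄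
  obtain ⟨-, habs⟩ := abs_tsum_inv_pow_sub_hurwitzNatMain_le hc hs J hν
  obtain ⟨h1, h2⟩ := abs_le.1 habs
  push_cast at h1 h2
  have hlo := (mem_ratBox S ((m₀ : ℚ) ^ s * (hurwitzNatMain (B₄ : ℚ) J ν s - hurwitzNatTail (B₄ : ℚ) J ν s))).1
  have hhi := (mem_ratBox S ((m₀ : ℚ) ^ s * (hurwitzNatMain (B₄ : ℚ) J ν s + hurwitzNatTail (B₄ : ℚ) J ν s))).2
  have hSn : (0 : ℝ) ≤ (S : ℝ) := by positivity
  have hp : (0 : ℝ) ≤ (m₀ : ℝ) ^ s := by positivity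
  unfold pureFarScaledBox
  constructor
  · refine hlo.trans ?_
    push_cast
    exact mul_le_mul_of_nonneg_right (mul_le_mul_of_nonneg_left (by linarith) hp) hSn
  · refine le_trans ?_ hhi
    push_cast
    exact mul_le_mul_of_nonneg_right (mul_le_mul_of_nonneg_left (by linarith) hp) hSn

/-! ## `log` tag against the pure tag: `Σ'_k log(B₄+k)·(m₀/(B₄+k))^s` -/

/-- **Far `log` tail, rescaled**: lower end from `m₀^s·F_{s−1}(B₄)`, upper end from `m₀^s·F_{s−1}(B₄−1)`,
`F_k(x) = (log x/k + 1/k²)/x^k`; `log` by `MI.logNat S K`. (`none` if a logarithm box fails.) -/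
def logFarScaledBox (S K : ℕ) (m₀ B₄ s : ℕ) : Option MI :=
  match MI.logNat S K B₄, MI.logNat S K (B₄ - 1) with
  | some L, some L1 =>
    some ⟨((mulRatBox L ((m₀ : ℚ) ^ s / (((s - 1 : ℕ) : ℚ) * (B₄ : ℚ) ^ (s - 1)))).add
            (ratBox S ((m₀ : ℚ) ^ s / (((s - 1 : ℕ) : ℚ) ^ 2 * (B₄ : ℚ) ^ (s - 1))))).lo,
          ((mulRatBox L1 ((m₀ : ℚ) ^ s / (((s - 1 : ℕ) : ℚ) * ((B₄ : ℚ) - 1) ^ (s - 1)))).add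
            (ratBox S ((m₀ : ℚ) ^ s / (((s - 1 : ℕ) : ℚ) ^ 2 * ((B₄ : ℚ) - 1) ^ (s - 1))))).hi⟩
  | _, _ => none

/-- **`logFarScaledBox ∋ Σ'_k log(B₄+k)·(m₀/(B₄+k))^s`** (`B₄ ≥ 3`, `s ≥ 2`). -/
theorem mem_logFarScaledBox (hS : 0 < S) {K m₀ B₄ s : ℕ} (hB₄ : 3 ≤ B₄) (hs : 2 ≤ s) {B : MI}
    (h : logFarScaledBox S K m₀ B₄ s = some B) :
    MI.mem S (∑' k : ℕ, Real.log ((B₄ + k : ℕ) : ℝ) * ((m₀ : ℝ) / ((B₄ + k : ℕ) : ℝ)) ^ s) B := by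
  obtain ⟨k, rfl⟩ : ∃ k, s = k + 1 := ⟨s - 1, by omega⟩
  have hk : 1 ≤ k := by omega
  have e : (fun j : ℕ ↦ Real.log ((B₄ + j : ℕ) : ℝ) * ((m₀ : ℝ) / ((B₄ + j : ℕ) : ℝ)) ^ (k + 1))
      = fun j : ℕ ↦ (m₀ : ℝ) ^ (k + 1) * (Real.log ((B₄ : ℝ) + j) / ((B₄ : ℝ) + j) ^ (k + 1)) := by
    funext j; push_cast; rw [div_pow]; ring
  rw [e, tsum_mul_left]
  have hlow := le_tsum_log_div_add_pow hk hB₄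
  have hup := (summable_log_div_add_pow hk hB₄).2
  have hSn : (0 : ℝ) ≤ (S : ℝ) := by positivity
  have hp : (0 : ℝ) ≤ (m₀ : ℝ) ^ (k + 1) := by positivity
  have hkR : (0 : ℝ) < k := by exact_mod_cast hk
  have hB : (3 : ℝ) ≤ B₄ := by exact_mod_cast hB₄
  have hcast : ((B₄ - 1 : ℕ) : ℝ) = (B₄ : ℝ) - 1 := by
    rw [Nat.cast_pred (by omega)]
  unfold logFarScaledBox at h
  split at h
  · rename_i L L1 hL hL1
    simp only [Option.some.injEq, Nat.add_sub_cancel] at h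
    subst h
    have hmL := MI.mem_logNat hS hL
    have hmL1 := MI.mem_logNat hS hL1
    rw [hcast] at hmL1
    have hA := MI.mem_add (mem_mulRatBox hmL ((m₀ : ℚ) ^ (k + 1) / (((k : ℕ) : ℚ) * (B₄ : ℚ) ^ k)))
      (mem_ratBox S ((m₀ : ℚ) ^ (k + 1) / (((k : ℕ) : ℚ) ^ 2 * (B₄ : ℚ) ^ k)))
    have hBx := MI.mem_add (mem_mulRatBox hmL1 ((m₀ : ℚ) ^ (k + 1) / (((k : ℕ) : ℚ) * ((B₄ : ℚ) - 1) ^ k)))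
      (mem_ratBox S ((m₀ : ℚ) ^ (k + 1) / (((k : ℕ) : ℚ) ^ 2 * ((B₄ : ℚ) - 1) ^ k)))
    have vA : Real.log (B₄ : ℝ) * (((m₀ : ℚ) ^ (k + 1) / (((k : ℕ) : ℚ) * (B₄ : ℚ) ^ k) : ℚ) : ℝ)
          + (((m₀ : ℚ) ^ (k + 1) / (((k : ℕ) : ℚ) ^ 2 * (B₄ : ℚ) ^ k) : ℚ) : ℝ)
        = (m₀ : ℝ) ^ (k + 1) * ((Real.log (B₄ : ℝ) / k + 1 / (k : ℝ) ^ 2) / (B₄ : ℝ) ^ k) := by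
      push_cast; ring
    have vB : Real.log ((B₄ : ℝ) - 1) * (((m₀ : ℚ) ^ (k + 1) / (((k : ℕ) : ℚ) * ((B₄ : ℚ) - 1) ^ k) : ℚ) : ℝ)
          + (((m₀ : ℚ) ^ (k + 1) / (((k : ℕ) : ℚ) ^ 2 * ((B₄ : ℚ) - 1) ^ k) : ℚ) : ℝ)
        = (m₀ : ℝ) ^ (k + 1) * ((Real.log ((B₄ : ℝ) - 1) / k + 1 / (k : ℝ) ^ 2) / ((B₄ : ℝ) - 1) ^ k) := by
      push_cast; ring
    rw [vA] at hA
    rw [vB] at hBx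
    constructor
    · exact hA.1.trans (mul_le_mul_of_nonneg_right (mul_le_mul_of_nonneg_left hlow hp) hSn)
    · exact le_trans (mul_le_mul_of_nonneg_right (mul_le_mul_of_nonneg_left hup hp) hSn) hBx.2
  · simp at h

/-! ## `log` tag against itself: `Σ'_k log²(B₄+k)·(m₀/(B₄+k))^s` -/

/-- **Far `log²` tail, rescaled**: lower end from `m₀^s·G_{s−1}(B₄)`, upper end from `m₀^s·G_{s−1}(B₄−1)`,
`G_k(x) = (log²x/k + 2 log x/k² + 2/k³)/x^k`. (`none` if a logarithm box fails.) -/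
def logSqFarScaledBox (S K : ℕ) (m₀ B₄ s : ℕ) : Option MI :=
  match MI.logNat S K B₄, MI.logNat S K (B₄ - 1) with
  | some L, some L1 =>
    some ⟨(((mulRatBox (MI.mul S L L) ((m₀ : ℚ) ^ s / (((s - 1 : ℕ) : ℚ) * (B₄ : ℚ) ^ (s - 1)))).add
            (mulRatBox L (2 * (m₀ : ℚ) ^ s / (((s - 1 : ℕ) : ℚ) ^ 2 * (B₄ : ℚ) ^ (s - 1))))).add
            (ratBox S (2 * (m₀ : ℚ) ^ s / (((s - 1 : ℕ) : ℚ) ^ 3 * (B₄ : ℚ) ^ (s - 1))))).lo,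
          (((mulRatBox (MI.mul S L1 L1) ((m₀ : ℚ) ^ s / (((s - 1 : ℕ) : ℚ) * ((B₄ : ℚ) - 1) ^ (s - 1)))).add
            (mulRatBox L1 (2 * (m₀ : ℚ) ^ s / (((s - 1 : ℕ) : ℚ) ^ 2 * ((B₄ : ℚ) - 1) ^ (s - 1))))).add
            (ratBox S (2 * (m₀ : ℚ) ^ s / (((s - 1 : ℕ) : ℚ) ^ 3 * ((B₄ : ℚ) - 1) ^ (s - 1))))).hi⟩
  | _, _ => none

/-- **`logSqFarScaledBox ∋ Σ'_k log²(B₄+k)·(m₀/(B₄+k))^s`** (`B₄ ≥ 4`, `s ≥ 2`). -/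
theorem mem_logSqFarScaledBox (hS : 0 < S) {K m₀ B₄ s : ℕ} (hB₄ : 4 ≤ B₄) (hs : 2 ≤ s) {B : MI}
    (h : logSqFarScaledBox S K m₀ B₄ s = some B) :
    MI.mem S (∑' k : ℕ, Real.log ((B₄ + k : ℕ) : ℝ) ^ 2 * ((m₀ : ℝ) / ((B₄ + k : ℕ) : ℝ)) ^ s) B := by
  obtain ⟨k, rfl⟩ : ∃ k, s = k + 1 := ⟨s - 1, by omega⟩
  have hk : 1 ≤ k := by omega
  have e : (fun j : ℕ ↦ Real.log ((B₄ + j : ℕ) : ℝ) ^ 2 * ((m₀ : ℝ) / ((B₄ + j : ℕ) : ℝ)) ^ (k + 1))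
      = fun j : ℕ ↦ (m₀ : ℝ) ^ (k + 1) * (Real.log ((B₄ : ℝ) + j) ^ 2 / ((B₄ : ℝ) + j) ^ (k + 1)) := by
    funext j; push_cast; rw [div_pow]; ring
  rw [e, tsum_mul_left]
  have hlow := le_tsum_logSq_div_add_pow hk hB₄
  have hup := (summable_logSq_div_add_pow hk hB₄).2
  have hSn : (0 : ℝ) ≤ (S : ℝ) := by positivity
  have hp : (0 : ℝ) ≤ (m₀ : ℝ) ^ (k + 1) := by positivity
  have hcast : ((B₄ - 1 : ℕ) : ℝ) = (B₄ : ℝ) - 1 := by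
    rw [Nat.cast_pred (by omega)]
  unfold logSqFarScaledBox at h
  split at h
  · rename_i L L1 hL hL1
    simp only [Option.some.injEq, Nat.add_sub_cancel] at h
    subst h
    have hmL := MI.mem_logNat hS hL
    have hmL1 := MI.mem_logNat hS hL1
    rw [hcast] at hmL1
    have hA := MI.mem_add (MI.mem_add
      (mem_mulRatBox (MI.mem_mul hS hmL hmL) ((m₀ : ℚ) ^ (k + 1) / (((k : ℕ) : ℚ) * (B₄ : ℚ) ^ k)))
      (mem_mulRatBox hmL (2 * (m₀ : ℚ) ^ (k + 1) / (((k : ℕ) : ℚ) ^ 2 * (B₄ : ℚ) ^ k))))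
      (mem_ratBox S (2 * (m₀ : ℚ) ^ (k + 1) / (((k : ℕ) : ℚ) ^ 3 * (B₄ : ℚ) ^ k)))
    have hBx := MI.mem_add (MI.mem_add
      (mem_mulRatBox (MI.mem_mul hS hmL1 hmL1) ((m₀ : ℚ) ^ (k + 1) / (((k : ℕ) : ℚ) * ((B₄ : ℚ) - 1) ^ k)))
      (mem_mulRatBox hmL1 (2 * (m₀ : ℚ) ^ (k + 1) / (((k : ℕ) : ℚ) ^ 2 * ((B₄ : ℚ) - 1) ^ k))))
      (mem_ratBox S (2 * (m₀ : ℚ) ^ (k + 1) / (((k : ℕ) : ℚ) ^ 3 * ((B₄ : ℚ) - 1) ^ k)))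
    have vA : Real.log (B₄ : ℝ) * Real.log (B₄ : ℝ)
            * (((m₀ : ℚ) ^ (k + 1) / (((k : ℕ) : ℚ) * (B₄ : ℚ) ^ k) : ℚ) : ℝ)
          + Real.log (B₄ : ℝ) * ((2 * (m₀ : ℚ) ^ (k + 1) / (((k : ℕ) : ℚ) ^ 2 * (B₄ : ℚ) ^ k) : ℚ) : ℝ)
          + ((2 * (m₀ : ℚ) ^ (k + 1) / (((k : ℕ) : ℚ) ^ 3 * (B₄ : ℚ) ^ k) : ℚ) : ℝ)
        = (m₀ : ℝ) ^ (k + 1) * ((Real.log (B₄ : ℝ) ^ 2 / k + 2 * Real.log (B₄ : ℝ) / (k : ℝ) ^ 2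
            + 2 / (k : ℝ) ^ 3) / (B₄ : ℝ) ^ k) := by
      push_cast; ring
    have vB : Real.log ((B₄ : ℝ) - 1) * Real.log ((B₄ : ℝ) - 1)
            * (((m₀ : ℚ) ^ (k + 1) / (((k : ℕ) : ℚ) * ((B₄ : ℚ) - 1) ^ k) : ℚ) : ℝ)
          + Real.log ((B₄ : ℝ) - 1) * ((2 * (m₀ : ℚ) ^ (k + 1) / (((k : ℕ) : ℚ) ^ 2 * ((B₄ : ℚ) - 1) ^ k) : ℚ) : ℝ)
          + ((2 * (m₀ : ℚ) ^ (k + 1) / (((k : ℕ) : ℚ) ^ 3 * ((B₄ : ℚ) - 1) ^ k) : ℚ) : ℝ)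
        = (m₀ : ℝ) ^ (k + 1) * ((Real.log ((B₄ : ℝ) - 1) ^ 2 / k + 2 * Real.log ((B₄ : ℝ) - 1) / (k : ℝ) ^ 2
            + 2 / (k : ℝ) ^ 3) / ((B₄ : ℝ) - 1) ^ k) := by
      push_cast; ring
    rw [vA] at hA
    rw [vB] at hBx
    constructor
    · exact hA.1.trans (mul_le_mul_of_nonneg_right (mul_le_mul_of_nonneg_left hlow hp) hSn)
    · exact le_trans (mul_le_mul_of_nonneg_right (mul_le_mul_of_nonneg_left hup hp) hSn) hBx.2
  · simp at h

end CinfCoeff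

end Summit.RiemannHypothesis.RiemannHypothesis.Theorems.WeilFormatC
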